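import Literature.Probability.Percolation.MarkedLoopNecessityFive
import HarnessLib

/-!
# Corner sides pin picture entries, for every number of marks: the face relation at a two-corner face tests only the pictures through both corners («CORNER-SIDE SUPPORT»)

Topic `Literature/Probability/Percolation`; generic-`k` layer of the marked-loop (Khristoforov–Smirnov) lineage; a rider on `MarkedLoopHolomorphicDefect.lean`
(TRIPOD-DEFECT: `sum_tau_obsW_eq_sum_pictureCount` — at every face `v` with three `H_G`-sides, `Σ_i τ^i ObsW D wt v i = Σ_P c_P(v) · defectAt wt P`, `c_P(v)` the
number of re-linking cores at `v` with picture `P`) and on `MarkedLoopNecessityFive.lean` § CornerSide (for EVERY `k`: `hasPicture_corner_side` — if the neighbour of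
`v` across side `i` is the corner face `y_a`, every picture counted at `v` reads `a` at position `i`; `exists_hasPicture_of_pictureCount_ne_zero`).

The lane's census road to the necessity of the tripod law (door (U): NEC 5 / NEC 7 in the tree, NEC 9 / NEC 11 numerically) runs through TWO-CORNER FACES — boundary faces
two of whose sides meet corner hexagons `y_a`, `y_b`. This file records, for every number of marks, WHAT SUCH A FACE CAN SEE:

* `pictureCount_eq_zero_of_corner_side` — across a corner side `i` to `y_a`, a picture NOT reading `a` at position `i` is never counted; the three positional forms
  `pictureCount_eq_zero_of_fst_ne` / `_snd_ne` / `_thd_ne`;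
* ★ `sum_tau_obsW_eq_sum_filter_corner_side` — THE FACE RELATION RESTRICTED: with a corner side `i` to `y_a`, `Σ_i τ^i ObsW = Σ_{P reads a at i} c_P · defectAt wt P`;
* ★★ `sum_tau_obsW_eq_zero_of_corner_side` / ★★★ `sum_tau_obsW_eq_zero_of_two_corner_sides` — **A TWO-CORNER FACE TESTS ONLY THE DEFECTS OF THE PICTURES THROUGH BOTH
  CORNERS**: if `defectAt wt P = 0` for every picture reading `a` at side `i` and `b` at side `i'`, then the holomorphicity relation holds at `v`, for EVERY class weight
  `wt` and every `k`. Consequently the defects of pictures whose triple avoids every pair of corners adjacent to a common face (the «isolated-triple» pictures: 0, 0, 3,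
  22, 117, 550 of the (2l+1)·C_l − C_{l+1} pictures for k = 5, 7, 9, 11, 13, 15) are invisible to the whole two-corner family — they need faces with at most one
  corner side (at `k = 9` these are the three rotation-invariant triangles); `sum_tau_obsW_eq_sum_filter_two_corner_sides` (the defect formula restricted to those
  pictures), `sum_tau_obsW_eq_of_two_corner_sides` (two weights with equal defects there have equal relations at `v`).

These are the kernel half of the lane's «two-corner reduction» of door (U) (HOME `FINDING-TRIPOD-DOOR-U-TWO-CORNER.md`, b-engine-2 g21): the relation of a two-corner face at
the consecutive corners `a, a+1` is a boundary pattern-count functional of the `(k−2)`-disorder theory, so the two-corner family kills every consecutive-pair defect iff the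
boundary count vectors of `(k−2)`-marked domains span (exact kit ranks: 81/81 at `k = 9`, 308/308 at `k = 11` on the two-wide rhombi with every marking).

## References
* M. Khristoforov, S. Smirnov, *Percolation and O(1) loop model*, arXiv:2111.15612 (2021), §2 Lemma 4, proof and Fig. 3 (arXiv v1 p. 4: the grouping of configurations
  around a vertex into triples; the three legs of a core); §1.2 (p. 2: link patterns of loop configurations with disorders).
* B. Bollobás, O. Riordan, *Percolation*, CUP (2006), Ch. 7 §7.2.2 (pp. 191–195: marked discrete domains, corner faces).

## Mathlib / tree
Tree: `MarkedLoopHolomorphicDefect.lean` (`PicIdx`, `defectAt`, `pictureCount`, `HasPicture`, `coreSetb`, `sum_tau_obsW_eq_sum_pictureCount`), `MarkedLoopNecessityFive.lean`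
(`hasPicture_corner_side`, `exists_hasPicture_of_pictureCount_ne_zero`), `MarkedLoopHolomorphy.lean` (`ObsW`, `HolomorphicW`, `AllSides`, `yc`, `oppFace`). Mathlib:
`Finset.sum_filter`, `Finset.sum_eq_zero`.
-/

open Finset

namespace Literature.Probability.Percolation.MarkedLoops

open Literature.Probability.Percolation Literature.Probability.LatticeModels
open Literature.Probability.Percolation.FivePoint (tau)
open TriMarkedDomain

variable {nm : ℕ} {D : TriMarkedDomain nm}

/-! ### One corner side pins one entry -/

/-- **a picture reads `a` at position `i`** (`i = 0, 1, 2`: the first / second / third corner of the triple). [cite: KhristoforovSmirnov2021, §2 Lemma 4, proof and Fig. 3 (arXiv v1 p. 4)] -/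
def PicIdx.ReadsAt (P : PicIdx nm) (i : Fin 3) (a : Fin nm) : Prop := (i = 0 → P.1 = a) ∧ (i = 1 → P.2.1 = a) ∧ (i = 2 → P.2.2.1 = a)

/-- reading at position `0` is the first entry. [cite: KhristoforovSmirnov2021, §2 Lemma 4 (arXiv v1 p. 4)] -/
theorem PicIdx.readsAt_zero (P : PicIdx nm) (a : Fin nm) : P.ReadsAt 0 a ↔ P.1 = a :=
  ⟨fun h => h.1 rfl, fun h => ⟨fun _ => h, fun e => absurd e (by decide), fun e => absurd e (by decide)⟩⟩

/-- reading at position `1` is the second entry. [cite: KhristoforovSmirnov2021, §2 Lemma 4 (arXiv v1 p. 4)] -/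
theorem PicIdx.readsAt_one (P : PicIdx nm) (a : Fin nm) : P.ReadsAt 1 a ↔ P.2.1 = a :=
  ⟨fun h => h.2.1 rfl, fun h => ⟨fun e => absurd e (by decide), fun _ => h, fun e => absurd e (by decide)⟩⟩

/-- reading at position `2` is the third entry. [cite: KhristoforovSmirnov2021, §2 Lemma 4 (arXiv v1 p. 4)] -/
theorem PicIdx.readsAt_two (P : PicIdx nm) (a : Fin nm) : P.ReadsAt 2 a ↔ P.2.2.1 = a :=
  ⟨fun h => h.2.2 rfl, fun h => ⟨fun e => absurd e (by decide), fun e => absurd e (by decide), fun _ => h⟩⟩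

/-- ★ **A CORNER SIDE PINS THE ENTRY, FOR EVERY `k`**: if side `i` of `v` meets the corner hexagon `y_a`, a picture not reading `a` at position `i` is never counted at `v`.
[cite: KhristoforovSmirnov2021, §2 Lemma 4, proof and Fig. 3 (arXiv v1 p. 4); BollobasRiordan2006, Ch. 7 §7.2.2 (pp. 191–195)] -/
theorem pictureCount_eq_zero_of_corner_side {v : HexVertex} (hv : AllSides D v) {i : Fin 3} {a : Fin nm} (ha : oppFace v i = yc D a) {P : PicIdx nm}
    (hP : ¬ P.ReadsAt i a) : pictureCount D v P = 0 := by
  by_contra h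
  obtain ⟨q, hq, hqP⟩ := exists_hasPicture_of_pictureCount_ne_zero h
  exact hP (hasPicture_corner_side hv ha hq hqP)

/-- first-entry form. [cite: KhristoforovSmirnov2021, §2 Lemma 4 (arXiv v1 p. 4)] -/
theorem pictureCount_eq_zero_of_fst_ne {v : HexVertex} (hv : AllSides D v) {a : Fin nm} (ha : oppFace v 0 = yc D a) {P : PicIdx nm} (hP : P.1 ≠ a) :
    pictureCount D v P = 0 :=
  pictureCount_eq_zero_of_corner_side hv ha (fun h => hP ((P.readsAt_zero a).1 h))

/-- second-entry form. [cite: KhristoforovSmirnov2021, §2 Lemma 4 (arXiv v1 p. 4)] -/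
theorem pictureCount_eq_zero_of_snd_ne {v : HexVertex} (hv : AllSides D v) {a : Fin nm} (ha : oppFace v 1 = yc D a) {P : PicIdx nm} (hP : P.2.1 ≠ a) :
    pictureCount D v P = 0 :=
  pictureCount_eq_zero_of_corner_side hv ha (fun h => hP ((P.readsAt_one a).1 h))

/-- third-entry form. [cite: KhristoforovSmirnov2021, §2 Lemma 4 (arXiv v1 p. 4)] -/
theorem pictureCount_eq_zero_of_thd_ne {v : HexVertex} (hv : AllSides D v) {a : Fin nm} (ha : oppFace v 2 = yc D a) {P : PicIdx nm} (hP : P.2.2.1 ≠ a) :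
    pictureCount D v P = 0 :=
  pictureCount_eq_zero_of_corner_side hv ha (fun h => hP ((P.readsAt_two a).1 h))

/-! ### The face relation restricted to what a corner side can see -/

open Classical in
/-- ★ **THE FACE RELATION RESTRICTED BY A CORNER SIDE**: with side `i` of `v` on the corner hexagon `y_a`, `Σ_i τ^i ObsW D wt v i = Σ_{P reads a at i} c_P(v) · defectAt wt P`,
for EVERY class weight and every `k`. [cite: KhristoforovSmirnov2021, §2 Lemma 4, proof and Fig. 3 (arXiv v1 p. 4)] -/
theorem sum_tau_obsW_eq_sum_filter_corner_side (wt : Fin nm → Finset (Fin nm × Fin nm) → ℂ) {v : HexVertex} (hv : AllSides D v) {i : Fin 3} {a : Fin nm}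
    (ha : oppFace v i = yc D a) :
    ∑ j : Fin 3, tau ^ (j : ℕ) * ObsW D wt v j = ∑ P ∈ (Finset.univ : Finset (PicIdx nm)).filter (fun P => P.ReadsAt i a), (pictureCount D v P : ℂ) * defectAt wt P := by
  classical
  rw [sum_tau_obsW_eq_sum_pictureCount wt hv, Finset.sum_filter]
  refine Finset.sum_congr rfl fun P _ => ?_
  split_ifs with h
  · rfl
  · rw [pictureCount_eq_zero_of_corner_side hv ha h, Nat.cast_zero, zero_mul]

/-- ★★ **ONE CORNER SIDE: the relation at `v` tests only the pictures reading `a` at `i`** — if their defects vanish, `v` is a holomorphicity point for `wt`.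
[cite: KhristoforovSmirnov2021, §2 Lemma 4, proof and Fig. 3 (arXiv v1 p. 4)] -/
theorem sum_tau_obsW_eq_zero_of_corner_side (wt : Fin nm → Finset (Fin nm × Fin nm) → ℂ) {v : HexVertex} (hv : AllSides D v) {i : Fin 3} {a : Fin nm}
    (ha : oppFace v i = yc D a) (h : ∀ P : PicIdx nm, P.ReadsAt i a → defectAt wt P = 0) : ∑ j : Fin 3, tau ^ (j : ℕ) * ObsW D wt v j = 0 := by
  classical
  rw [sum_tau_obsW_eq_sum_filter_corner_side wt hv ha]
  exact Finset.sum_eq_zero fun P hP => by rw [h P (Finset.mem_filter.1 hP).2, mul_zero]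

/-- ★★★ **A TWO-CORNER FACE TESTS ONLY THE DEFECTS OF THE PICTURES THROUGH BOTH CORNERS, FOR EVERY `k`**: if sides `i`, `i'` of `v` meet the corner hexagons `y_a`, `y_b` and
`defectAt wt P = 0` for every picture reading `a` at `i` and `b` at `i'`, then the holomorphicity relation `Σ_j τ^j ObsW D wt v j = 0` holds at `v` — whatever the other
defects are. (So the pictures whose triple avoids every such pair — the «isolated-triple» pictures — are invisible to the two-corner family.)
[cite: KhristoforovSmirnov2021, §2 Lemma 4, proof and Fig. 3 (arXiv v1 p. 4); BollobasRiordan2006, Ch. 7 §7.2.2 (pp. 191–195)] -/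
theorem sum_tau_obsW_eq_zero_of_two_corner_sides (wt : Fin nm → Finset (Fin nm × Fin nm) → ℂ) {v : HexVertex} (hv : AllSides D v) {i i' : Fin 3} {a b : Fin nm}
    (ha : oppFace v i = yc D a) (hb : oppFace v i' = yc D b) (h : ∀ P : PicIdx nm, P.ReadsAt i a → P.ReadsAt i' b → defectAt wt P = 0) :
    ∑ j : Fin 3, tau ^ (j : ℕ) * ObsW D wt v j = 0 := by
  classical
  rw [sum_tau_obsW_eq_sum_pictureCount wt hv]
  refine Finset.sum_eq_zero fun P _ => ?_
  by_cases h1 : P.ReadsAt i a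
  · by_cases h2 : P.ReadsAt i' b
    · rw [h P h1 h2, mul_zero]
    · rw [pictureCount_eq_zero_of_corner_side hv hb h2, Nat.cast_zero, zero_mul]
  · rw [pictureCount_eq_zero_of_corner_side hv ha h1, Nat.cast_zero, zero_mul]

open Classical in
/-- ★★ the two-corner restriction of the defect formula: `Σ_j τ^j ObsW = Σ_{P reads a at i and b at i'} c_P · defectAt wt P`.
[cite: KhristoforovSmirnov2021, §2 Lemma 4, proof and Fig. 3 (arXiv v1 p. 4)] -/
theorem sum_tau_obsW_eq_sum_filter_two_corner_sides (wt : Fin nm → Finset (Fin nm × Fin nm) → ℂ) {v : HexVertex} (hv : AllSides D v) {i i' : Fin 3}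
    {a b : Fin nm} (ha : oppFace v i = yc D a) (hb : oppFace v i' = yc D b) :
    ∑ j : Fin 3, tau ^ (j : ℕ) * ObsW D wt v j =
      ∑ P ∈ (Finset.univ : Finset (PicIdx nm)).filter (fun P => P.ReadsAt i a ∧ P.ReadsAt i' b), (pictureCount D v P : ℂ) * defectAt wt P := by
  classical
  rw [sum_tau_obsW_eq_sum_pictureCount wt hv, Finset.sum_filter]
  refine Finset.sum_congr rfl fun P _ => ?_
  split_ifs with h
  · rfl
  · by_cases h1 : P.ReadsAt i a
    · rw [pictureCount_eq_zero_of_corner_side hv hb (fun h2 => h ⟨h1, h2⟩), Nat.cast_zero, zero_mul]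
    · rw [pictureCount_eq_zero_of_corner_side hv ha h1, Nat.cast_zero, zero_mul]

/-- ★ **consequently two class weights with the same defects on the pictures through both corners have the same relation at `v`** (the other defects do not enter).
[cite: KhristoforovSmirnov2021, §2 Lemma 4, proof and Fig. 3 (arXiv v1 p. 4)] -/
theorem sum_tau_obsW_eq_of_two_corner_sides {wt wt' : Fin nm → Finset (Fin nm × Fin nm) → ℂ} {v : HexVertex} (hv : AllSides D v) {i i' : Fin 3} {a b : Fin nm}
    (ha : oppFace v i = yc D a) (hb : oppFace v i' = yc D b) (h : ∀ P : PicIdx nm, P.ReadsAt i a → P.ReadsAt i' b → defectAt wt P = defectAt wt' P) :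
    ∑ j : Fin 3, tau ^ (j : ℕ) * ObsW D wt v j = ∑ j : Fin 3, tau ^ (j : ℕ) * ObsW D wt' v j := by
  classical
  rw [sum_tau_obsW_eq_sum_filter_two_corner_sides wt hv ha hb, sum_tau_obsW_eq_sum_filter_two_corner_sides wt' hv ha hb]
  refine Finset.sum_congr rfl fun P hP => ?_
  obtain ⟨h1, h2⟩ := (Finset.mem_filter.1 hP).2
  rw [h P h1 h2]

end Literature.Probability.Percolation.MarkedLoops
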